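import Summits.QuantumFields.YangMills.Theorems.BalabanUVNodesN21ThresholdMixtureRStepCommonBox
import Summits.QuantumFields.YangMills.Theorems.BalabanUVNodesN21ThresholdMixtureRecordChiAtRecord
import Summits.QuantumFields.YangMills.Theorems.BalabanUVNodesN21ThresholdMixtureTStepChiAtRecord
import Literature.MathematicalPhysics.QuantumFieldTheory.Balaban1983to89.T4JointDressingMany

/-!
# N21 (NE7c), strategy s3 «alternative currency», file 22 — KT-28 AT THE RECORD'S LETTERS REDUCES TO TWO NAMED FACTS: LOCALITY of the (2.16) background
# map on `□^{≈4}` (def-χ) and BOND-DISJOINTNESS of the fibre from those cubes (def-R's `fibOfSeq` geometry, (2.2)–(2.3) margins)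

Seat `pub-ymgap-dag-n21-e` (R141 (C) fan-out, node N21 = NE7c `T4IndicatorShell.ShellWeightBound`, strategy s3), g8.  Lane: `--kind proof
--supports stmt-QuantumFields-20292 --as helper` (K3⁗ `SpineGivenEndpointR13Sep`).  Count-neutral.  Files 20∕21 (`…RStepFactors` p512646, `…RStepCommonBox`)
consume the lens's kill-test KT-28 («does `fibOfSeq` contain window-cube bonds?», `LENS-nearmiss.md` v9.0 Card 28) as the hypothesis `T4DressedR.FibreIndep (fib a) (u c)`
on the tested variables of the randomised occurrences.  At the record those tested variables are COMPOSITES `V ↦ g(Φ_□(V))` — the block-sup of `dist1 ∘ plaqHol` (13a)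
AFTER the (2.16) background map `Φ_□ = B14.Eq216Concrete.ukBox (bgOfRecord …) M₁ □^{≈4} k` (13b p491885: the generation-`k` front factor; 14b p496646: the (3.2) label
factor through `Sect3Data.UkLoc`).  So KT-28 at the record is, by name, the conjunction of

* (LOC) LOCALITY of the background map: `Φ_□(V)` depends on `V` only through the bonds of a finite set `B_□` (print: `U_{k,□}(V_k)` is the minimal configuration on
  `□^∼` determined by `V_k⌈_{□^{≈}}`, [Balaban1988Convergent] (2.16) p. 257) — def-χ's to state for `ukBox`∕`bgOfRecord` (here the hypothesis `hdep`∕`hloc`);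
* (DISJ) BOND-DISJOINTNESS: the fibre bond set misses `B_□` for every cube `□` the term reads (print: `□ ⊂ Ω_k ⊂ Λ_k` with the (2.2)–(2.3) margins while
  `Z′ ⊂ Z_k = Λ_kᶜ`, def-R FILE 8 `sliceOfRecord.lastZ s = (s.Λ k)ᶜ`) — def-R's to state for `fibOfSeq` (here the hypothesis `hdisj`),

and then `FibreIndep` of every OFF record statistic, of the OFF PART of r11's `chi218` at def-R's datum (the sequence's front factor, split OFF × ON = file 20 §5's
`cOut · cFib`; with OFF DEFINED by disjointness only (LOC) remains, `fibreIndep_chi218_off_of_dependsOnBonds`) and of def-T's (3.2) label weight `Node00.aWeight`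
FOLLOWS (§2–§3) — the `hu`∕`huI` hypotheses of file 21 and the `hc` hypotheses of file 20 at these letters.  The lens ran KT-28 by READING def-R :217 (v10.0,
l.17969): ON = the cubes restored to small in `sel s` and their `R̃`-neighbours — they cost `(1+δ_loc)` (lens Card 30; my (O-mix-4)); everything else is OFF.
§1 is the three-line generic reduction (`fibreIndep_of_dependsOnBonds`, `local_of_dependsOnBonds`, `fibreIndep_comp_of_local`) plus the pol-free product lemma.

HONEST FRAMING.  NE7c is NOT PRINTED and NOT PROVED.  [folklore] bookkeeping (`Function.updateFinset` off the updated set; products); (LOC) and (DISJ) are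
DISPLAYED hypotheses — def-χ's ∕ def-R's facts about their own letters, NOT asserted here; nothing of Bałaban's asserted; N21 NOT discharged; count-neutral;
one finite 𝕋⁴ at fixed `ε`; NOT ℝ⁴ ∕ OS ∕ gap ∕ Clay.

CITATION HEADER (lean-in-tree rule 2026-08-18).  BY NAME: `T4DressedR.FibreIndep`; 13b `chi218_record_eq_prod_smallInd`;
14b `aWeight_eq_prod_fac_smallInd`; file 21 `fibreIndep_prod_fac_smallInd`; def-R `Node00.bgOfRecord` ∕ `avOfRecord` ∕ `epsOfRecord`; def-T
`Node00.aWeight` ∕ `sect3DataOfRecord` ∕ `cubes32`; r11 `B14.Eq218Concrete.chi218`; `B14.Eq216Concrete.ukBox`; `T4IndicatorShell.smallInd`; `T4JointDressingMany.fibreIntegral_empty`.  Context only (SHAPE):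
[Balaban1988Convergent] (2.16)–(2.17) p. 257, (3.2) p. 265; [Balaban1989LargeFieldI] (0.3) p. 176.

WHAT IS PROVED ([folklore]).  §1 `local_of_dependsOnBonds` · `fibreIndep_comp_of_local` · ★ `fibreIndep_of_dependsOnBonds` ·
`fibreIndep_prod_smallInd`; §2 `fibreIndep_recordStat_of_local` · ★ `chi218_record_eq_off_mul_on` · ★★ `fibreIndep_chi218_off_of_local` ·
★★ `fibreIndep_chi218_off_of_dependsOnBonds`; §3 `fibreIndep_tStepStat32_of_local` · ★ `fibreIndep_aWeight_of_local`; §4 (guard) `normTerm_empty_eq_ite`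
(with `T4JointDressingMany.fibreIntegral_empty`, cited).
-/

set_option autoImplicit false

noncomputable section

open MeasureTheory Set
open scoped BigOperators ENNReal

namespace Summit.QuantumFields.YangMills.Theorems.N21ThresholdMixtureRStepLocality

open Literature.MathematicalPhysics.QuantumFieldTheory.Balaban1983to89
open Literature.MathematicalPhysics.QuantumFieldTheory.Balaban1983to89.T4DressedR (FibreIndep)
open Literature.MathematicalPhysics.QuantumFieldTheory.Balaban1983to89.T4IndicatorShell
open Literature.MathematicalPhysics.QuantumFieldTheory.Balaban1983to89.T4LipschitzLedger
open Summit.QuantumFields.YangMills.Theorems.N21ThresholdMixtureRStepCommonBox (fibreIndep_prod_fac_smallInd)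

/-! ## §1 Generic: fibre-independence from bond-locality and disjointness -/

section Generic

variable {P : Params} {j : ℕ} {G : Type*} [GaugeGroup G] [MeasurableSpace G] [HaarData G]
variable [DecidableEq (PBond P j)]

omit [GaugeGroup G] [MeasurableSpace G] [HaarData G] in
/-- (LOC) + (DISJ) ⇒ invariance under fibre updates: a map of the field that depends only on the bonds of `B`, with `B` disjoint from the fibre `s`, is
unchanged by `updateFinset · s ·`. [folklore] -/
theorem local_of_dependsOnBonds {X : Type*} (Φ : GaugeField P j G → X) (B : Set (PBond P j)) (s : Finset (PBond P j))
    (hdep : ∀ V W : GaugeField P j G, (∀ b ∈ B, V b = W b) → Φ V = Φ W) (hdisj : ∀ b ∈ B, b ∉ s)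
    (V : GaugeField P j G) (y : s → G) : Φ (Function.updateFinset V s y) = Φ V :=
  hdep _ _ fun b hb => by simp only [Function.updateFinset, dif_neg (hdisj b hb)]

omit [GaugeGroup G] [MeasurableSpace G] [HaarData G] in
/-- A statistic read THROUGH a fibre-invariant map of the field is fibre-independent. [folklore] -/
theorem fibreIndep_comp_of_local {X : Type*} (Φ : GaugeField P j G → X) (g : X → ℝ) (s : Finset (PBond P j))
    (hloc : ∀ (V : GaugeField P j G) (y : s → G), Φ (Function.updateFinset V s y) = Φ V) :
    FibreIndep s (fun V => g (Φ V)) := fun V y => by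
  show g (Φ (Function.updateFinset V s y)) = g (Φ V)
  rw [hloc V y]

omit [GaugeGroup G] [MeasurableSpace G] [HaarData G] in
/-- ★ **KT-28 IN TWO NAMED FACTS**: (LOC) the map `Φ` depends on the field only through the bonds of `B`; (DISJ) `B` misses the fibre `s` ⇒ every statistic
`g ∘ Φ` is fibre-independent of `s`. [folklore] -/
theorem fibreIndep_of_dependsOnBonds {X : Type*} (Φ : GaugeField P j G → X) (g : X → ℝ) (B : Set (PBond P j)) (s : Finset (PBond P j))
    (hdep : ∀ V W : GaugeField P j G, (∀ b ∈ B, V b = W b) → Φ V = Φ W) (hdisj : ∀ b ∈ B, b ∉ s) :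
    FibreIndep s (fun V => g (Φ V)) :=
  fibreIndep_comp_of_local Φ g s (local_of_dependsOnBonds Φ B s hdep hdisj)

omit [GaugeGroup G] [MeasurableSpace G] [HaarData G] in
/-- A pure small-field sharp product of fibre-independent tested variables is fibre-independent (file 21's `fibreIndep_prod_fac_smallInd` at `pol ≡ small`,
with a common threshold). [folklore] -/
theorem fibreIndep_prod_smallInd {ι : Type*} (s : Finset (PBond P j)) (A : Finset ι) {u : ι → Density P j G} (hu : ∀ c ∈ A, FibreIndep s (u c))
    (θ : ℝ) : FibreIndep s (fun V => ∏ c ∈ A, smallInd (u c V) θ) := by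
  have h := fibreIndep_prod_fac_smallInd s A (fun _ => Pol.small) hu (fun _ => θ)
  simpa only [Pol.fac_small] using h

end Generic

/-! ## §2 At the record's χ-slots (13b's letters): the generation-`k` front factor -/

section AtRecord

open Literature.MathematicalPhysics.QuantumFieldTheory.Balaban1983to89.Node00
open T4Continuum B15DeterminingSets B14.Eq213DetSet B14.Eq216Concrete B14.Eq213MaximalDomains B15Eq112TorusCover B14DomainGeom
  B14.Eq218Concrete
open Summit.QuantumFields.YangMills.Theorems.N21ThresholdMixtureRecordChiAtRecord (chi218_record_eq_prod_smallInd)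

variable (F : T4Family) (N : ℕ) [NeZero N]

/-- **The record's block-sup statistic of cube `□` is fibre-independent of `s` once the (2.16) background map on `□^{≈4}` is invariant under `s`-updates** (LOC+DISJ
for that cube). [cite: Balaban1988Convergent, (2.16)–(2.17) p.257 (bookkeeping)] -/
theorem fibreIndep_recordStat_of_local (ν : Stage7Numerics) (g : ℕ → ℝ) (K k : ℕ) [DecidableEq (PBond (F.P K) k)] (s : Finset (PBond (F.P K) k))
    (a : Pt (F.P K).d)
    (hloc : ∀ (V : GaugeField (F.P K) k (SU N)) (y : s → SU N),
      ukBox (bgOfRecord (avOfRecord F N K) {U | PlaqSmall (ν.εreg * (F.P K).eta k ^ 2) U}) ν.M₁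
          (cubeEnl (F.P K) (cubeSide (F.P K).L ν.M₂ (RkOfRecord (F.P K).L ν.r (g k)) k) a 4) k (Function.updateFinset V s y)
        = ukBox (bgOfRecord (avOfRecord F N K) {U | PlaqSmall (ν.εreg * (F.P K).eta k ^ 2) U}) ν.M₁
          (cubeEnl (F.P K) (cubeSide (F.P K).L ν.M₂ (RkOfRecord (F.P K).L ν.r (g k)) k) a 4) k V) :
    FibreIndep s fun V : GaugeField (F.P K) k (SU N) =>
      ⨆ p : ↥(plaqInside (cubeEnl (F.P K) (cubeSide (F.P K).L ν.M₂ (RkOfRecord (F.P K).L ν.r (g k)) k) a 1)),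
        dist1 (GaugeField.plaqHol
          (ukBox (bgOfRecord (avOfRecord F N K) {U | PlaqSmall (ν.εreg * (F.P K).eta k ^ 2) U}) ν.M₁
            (cubeEnl (F.P K) (cubeSide (F.P K).L ν.M₂ (RkOfRecord (F.P K).L ν.r (g k)) k) a 4) k V) p.1) :=
  fibreIndep_comp_of_local _
    (fun W => ⨆ p : ↥(plaqInside (cubeEnl (F.P K) (cubeSide (F.P K).L ν.M₂ (RkOfRecord (F.P K).L ν.r (g k)) k) a 1)),
      dist1 (GaugeField.plaqHol W p.1)) s hloc

/-- **OFF∕ON SPLIT OF THE SEQUENCE's FRONT FACTOR** (file 20 §5's `r.χ a = cOut a · cFib a` at the record): for ANY set `On` of cubes, r11's `chi218` at def-R's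
datum is the product over the cubes of `Ω_k(s)` OFF `On` times the product over those ON it (13b's `chi218_record_eq_prod_smallInd` + `Finset.prod_filter_mul_prod_filter_not`).
The lens's reading of def-R :217 (v10.0): ON = the cubes restored to small in `sel s` and their `R̃`-neighbours. [cite: Balaban1988Convergent, (2.17)–(2.18) p.257] -/
theorem chi218_record_eq_off_mul_on (ν : Stage7Numerics) (g : ℕ → ℝ) (K k : ℕ) (hε : 0 < epsOfRecord ν g k * (F.P K).eta k ^ 2)
    {D : ℕ → Set (Set (Site (F.P K) 0))} (s : Seq D k) (On : Finset ↥(cubeIndices (F.P K) (cubeSide (F.P K).L ν.M₂ (RkOfRecord (F.P K).L ν.r (g k)) k))) (V : GaugeField (F.P K) k (SU N)) :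
    chi218 (ι := ↥(cubeIndices (F.P K) (cubeSide (F.P K).L ν.M₂ (RkOfRecord (F.P K).L ν.r (g k)) k)))
        (bgOfRecord (avOfRecord F N K) {U | PlaqSmall (ν.εreg * (F.P K).eta k ^ 2) U}) ν.M₁
        (fun a => cubeEnl (F.P K) (cubeSide (F.P K).L ν.M₂ (RkOfRecord (F.P K).L ν.r (g k)) k) a 0) (fun a => plaqInside (cubeEnl (F.P K) (cubeSide (F.P K).L ν.M₂ (RkOfRecord (F.P K).L ν.r (g k)) k) a 1)) (fun a => cubeEnl (F.P K) (cubeSide (F.P K).L ν.M₂ (RkOfRecord (F.P K).L ν.r (g k)) k) a 4) (epsOfRecord ν g k) k s V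
      = (∏ c ∈ (cubesIn (fun a : ↥(cubeIndices (F.P K) (cubeSide (F.P K).L ν.M₂ (RkOfRecord (F.P K).L ν.r (g k)) k)) => cubeEnl (F.P K) (cubeSide (F.P K).L ν.M₂ (RkOfRecord (F.P K).L ν.r (g k)) k) a 0) (s.Ω k)).filter (fun c => c ∉ On),
          smallInd (⨆ p : ↥(plaqInside (cubeEnl (F.P K) (cubeSide (F.P K).L ν.M₂ (RkOfRecord (F.P K).L ν.r (g k)) k) c 1)),
            dist1 (GaugeField.plaqHol
              (ukBox (bgOfRecord (avOfRecord F N K) {U | PlaqSmall (ν.εreg * (F.P K).eta k ^ 2) U}) ν.M₁ (cubeEnl (F.P K) (cubeSide (F.P K).L ν.M₂ (RkOfRecord (F.P K).L ν.r (g k)) k) c 4) k V) p.1))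
            (epsOfRecord ν g k * (F.P K).eta k ^ 2)) *
        ∏ c ∈ (cubesIn (fun a : ↥(cubeIndices (F.P K) (cubeSide (F.P K).L ν.M₂ (RkOfRecord (F.P K).L ν.r (g k)) k)) => cubeEnl (F.P K) (cubeSide (F.P K).L ν.M₂ (RkOfRecord (F.P K).L ν.r (g k)) k) a 0) (s.Ω k)).filter (fun c => ¬ c ∉ On),
          smallInd (⨆ p : ↥(plaqInside (cubeEnl (F.P K) (cubeSide (F.P K).L ν.M₂ (RkOfRecord (F.P K).L ν.r (g k)) k) c 1)),
            dist1 (GaugeField.plaqHol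
              (ukBox (bgOfRecord (avOfRecord F N K) {U | PlaqSmall (ν.εreg * (F.P K).eta k ^ 2) U}) ν.M₁ (cubeEnl (F.P K) (cubeSide (F.P K).L ν.M₂ (RkOfRecord (F.P K).L ν.r (g k)) k) c 4) k V) p.1))
            (epsOfRecord ν g k * (F.P K).eta k ^ 2) := by
  rw [chi218_record_eq_prod_smallInd F N ν g K k hε s V, Finset.prod_filter_mul_prod_filter_not]

/-- ★★ **THE OFF PART OF THE FRONT FACTOR IS FIBRE-INDEPENDENT** once the (2.16) background map of every OFF cube read by the sequence is invariant under fibre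
updates — file 20's `hc`∕`hc'` and file 21's `huI` at the record, for the sender (`s = a`) and the receiver (`s = sel a`) alike.
[cite: Balaban1988Convergent, (2.16)–(2.18) p.257; Balaban1989LargeFieldI, (0.3) p.176] -/
theorem fibreIndep_chi218_off_of_local (ν : Stage7Numerics) (g : ℕ → ℝ) (K k : ℕ) [DecidableEq (PBond (F.P K) k)]
    (fib : Finset (PBond (F.P K) k)) {D : ℕ → Set (Set (Site (F.P K) 0))} (s : Seq D k) (On : Finset ↥(cubeIndices (F.P K) (cubeSide (F.P K).L ν.M₂ (RkOfRecord (F.P K).L ν.r (g k)) k)))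
    (hloc : ∀ c ∈ cubesIn (fun a : ↥(cubeIndices (F.P K) (cubeSide (F.P K).L ν.M₂ (RkOfRecord (F.P K).L ν.r (g k)) k)) => cubeEnl (F.P K) (cubeSide (F.P K).L ν.M₂ (RkOfRecord (F.P K).L ν.r (g k)) k) a 0) (s.Ω k), c ∉ On →
      ∀ (V : GaugeField (F.P K) k (SU N)) (y : fib → SU N),
        ukBox (bgOfRecord (avOfRecord F N K) {U | PlaqSmall (ν.εreg * (F.P K).eta k ^ 2) U}) ν.M₁ (cubeEnl (F.P K) (cubeSide (F.P K).L ν.M₂ (RkOfRecord (F.P K).L ν.r (g k)) k) c 4) k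
            (Function.updateFinset V fib y)
          = ukBox (bgOfRecord (avOfRecord F N K) {U | PlaqSmall (ν.εreg * (F.P K).eta k ^ 2) U}) ν.M₁ (cubeEnl (F.P K) (cubeSide (F.P K).L ν.M₂ (RkOfRecord (F.P K).L ν.r (g k)) k) c 4) k V) :
    FibreIndep fib fun V : GaugeField (F.P K) k (SU N) =>
      ∏ c ∈ (cubesIn (fun a : ↥(cubeIndices (F.P K) (cubeSide (F.P K).L ν.M₂ (RkOfRecord (F.P K).L ν.r (g k)) k)) => cubeEnl (F.P K) (cubeSide (F.P K).L ν.M₂ (RkOfRecord (F.P K).L ν.r (g k)) k) a 0) (s.Ω k)).filter (fun c => c ∉ On),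
        smallInd (⨆ p : ↥(plaqInside (cubeEnl (F.P K) (cubeSide (F.P K).L ν.M₂ (RkOfRecord (F.P K).L ν.r (g k)) k) c 1)),
          dist1 (GaugeField.plaqHol
            (ukBox (bgOfRecord (avOfRecord F N K) {U | PlaqSmall (ν.εreg * (F.P K).eta k ^ 2) U}) ν.M₁ (cubeEnl (F.P K) (cubeSide (F.P K).L ν.M₂ (RkOfRecord (F.P K).L ν.r (g k)) k) c 4) k V) p.1))
          (epsOfRecord ν g k * (F.P K).eta k ^ 2) :=
  fibreIndep_prod_smallInd fib _
    (u := fun (c : ↥(cubeIndices (F.P K) (cubeSide (F.P K).L ν.M₂ (RkOfRecord (F.P K).L ν.r (g k)) k))) (V : GaugeField (F.P K) k (SU N)) =>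
      ⨆ p : ↥(plaqInside (cubeEnl (F.P K) (cubeSide (F.P K).L ν.M₂ (RkOfRecord (F.P K).L ν.r (g k)) k) c 1)),
        dist1 (GaugeField.plaqHol
          (ukBox (bgOfRecord (avOfRecord F N K) {U | PlaqSmall (ν.εreg * (F.P K).eta k ^ 2) U}) ν.M₁ (cubeEnl (F.P K) (cubeSide (F.P K).L ν.M₂ (RkOfRecord (F.P K).L ν.r (g k)) k) c 4) k V) p.1))
    (fun c hc => fibreIndep_recordStat_of_local F N ν g K k fib c.1
      (hloc c (Finset.mem_filter.1 hc).1 (Finset.mem_filter.1 hc).2)) _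

/-- ★★ **KT-28 FOR THE FRONT FACTOR IN THE TWO NAMED FACTS, WITH «OFF» DEFINED BY DISJOINTNESS.**  (LOC) each cube's (2.16) background map depends on the
field only through a finite bond set `B c` (def-χ's, about `ukBox`∕`bgOfRecord`).  Then for ANY fibre `fib` the product over the cubes of `Ω_k(s)` whose `B c`
MISSES `fib` is fibre-independent — no further hypothesis: (DISJ) is the definition of OFF, and which cubes are ON is def-R's `fibOfSeq` geometry (lens v10.0:
the restored cubes and their `R̃`-neighbours). [cite: Balaban1988Convergent, (2.16)–(2.17) p.257; Balaban1989LargeFieldI, (0.3) p.176] -/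
theorem fibreIndep_chi218_off_of_dependsOnBonds (ν : Stage7Numerics) (g : ℕ → ℝ) (K k : ℕ) [DecidableEq (PBond (F.P K) k)]
    (fib : Finset (PBond (F.P K) k)) {D : ℕ → Set (Set (Site (F.P K) 0))} (s : Seq D k)
    (B : ↥(cubeIndices (F.P K) (cubeSide (F.P K).L ν.M₂ (RkOfRecord (F.P K).L ν.r (g k)) k)) → Finset (PBond (F.P K) k))
    (hdep : ∀ (c : ↥(cubeIndices (F.P K) (cubeSide (F.P K).L ν.M₂ (RkOfRecord (F.P K).L ν.r (g k)) k))) (V W : GaugeField (F.P K) k (SU N)), (∀ b ∈ B c, V b = W b) →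
      ukBox (bgOfRecord (avOfRecord F N K) {U | PlaqSmall (ν.εreg * (F.P K).eta k ^ 2) U}) ν.M₁ (cubeEnl (F.P K) (cubeSide (F.P K).L ν.M₂ (RkOfRecord (F.P K).L ν.r (g k)) k) c 4) k V
        = ukBox (bgOfRecord (avOfRecord F N K) {U | PlaqSmall (ν.εreg * (F.P K).eta k ^ 2) U}) ν.M₁ (cubeEnl (F.P K) (cubeSide (F.P K).L ν.M₂ (RkOfRecord (F.P K).L ν.r (g k)) k) c 4) k W) :
    FibreIndep fib fun V : GaugeField (F.P K) k (SU N) =>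
      ∏ c ∈ (cubesIn (fun a : ↥(cubeIndices (F.P K) (cubeSide (F.P K).L ν.M₂ (RkOfRecord (F.P K).L ν.r (g k)) k)) => cubeEnl (F.P K) (cubeSide (F.P K).L ν.M₂ (RkOfRecord (F.P K).L ν.r (g k)) k) a 0) (s.Ω k)).filter (fun c => Disjoint (B c) fib),
        smallInd (⨆ p : ↥(plaqInside (cubeEnl (F.P K) (cubeSide (F.P K).L ν.M₂ (RkOfRecord (F.P K).L ν.r (g k)) k) c 1)),
          dist1 (GaugeField.plaqHol
            (ukBox (bgOfRecord (avOfRecord F N K) {U | PlaqSmall (ν.εreg * (F.P K).eta k ^ 2) U}) ν.M₁ (cubeEnl (F.P K) (cubeSide (F.P K).L ν.M₂ (RkOfRecord (F.P K).L ν.r (g k)) k) c 4) k V) p.1))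
          (epsOfRecord ν g k * (F.P K).eta k ^ 2) :=
  fibreIndep_prod_smallInd fib _
    (u := fun (c : ↥(cubeIndices (F.P K) (cubeSide (F.P K).L ν.M₂ (RkOfRecord (F.P K).L ν.r (g k)) k))) (V : GaugeField (F.P K) k (SU N)) =>
      ⨆ p : ↥(plaqInside (cubeEnl (F.P K) (cubeSide (F.P K).L ν.M₂ (RkOfRecord (F.P K).L ν.r (g k)) k) c 1)),
        dist1 (GaugeField.plaqHol
          (ukBox (bgOfRecord (avOfRecord F N K) {U | PlaqSmall (ν.εreg * (F.P K).eta k ^ 2) U}) ν.M₁ (cubeEnl (F.P K) (cubeSide (F.P K).L ν.M₂ (RkOfRecord (F.P K).L ν.r (g k)) k) c 4) k V) p.1))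
    (fun c hc => fibreIndep_recordStat_of_local F N ν g K k fib c.1 fun V y =>
      hdep c _ _ fun _ hb => by
        simp only [Function.updateFinset, dif_neg (Finset.disjoint_left.1 (Finset.mem_filter.1 hc).2 hb)]) _

end AtRecord

/-! ## §3 At the 𝐓-step's (3.2) slots (14b's letters): the label factor read through `Sect3Data.UkLoc` -/

section AtTStep

open Literature.MathematicalPhysics.QuantumFieldTheory.Balaban1983to89.Node00
open T4Continuum B14.Sect3Decomp
open Summit.QuantumFields.YangMills.Theorems.N21ThresholdMixtureTStepChiAtRecord (aWeight_eq_prod_fac_smallInd)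

variable (F : T4Family) (N : ℕ) [NeZero N] (ν : Stage7Numerics) (M : ℕ) (p : B12.RunParams) (g : ℕ → ℝ) (k : ℕ)

/-- **The (3.2) tested variable of cube `□′` is fibre-independent of `s` once the localized background `U_{k+1,□′}(·)` is invariant under `s`-updates** (LOC+DISJ one
level up). [cite: Balaban1988Convergent, (3.2) p.265, (2.16) p.257 (bookkeeping)] -/
theorem fibreIndep_tStepStat32_of_local [DecidableEq (PBond (F.P p.K) (k + 1))] (sq : SeqOfRecord F ν M g p.K k) (c : Iχ F ν p g k)
    (s : Finset (PBond (F.P p.K) (k + 1)))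
    (hloc : ∀ (V' : GaugeField (F.P p.K) (k + 1) (SU N)) (y : s → SU N),
      (sect3DataOfRecord F N ν M p g k sq).UkLoc c (Function.updateFinset V' s y) = (sect3DataOfRecord F N ν M p g k sq).UkLoc c V') :
    FibreIndep s fun V' : GaugeField (F.P p.K) (k + 1) (SU N) =>
      ⨆ q : ↥((sect3DataOfRecord F N ν M p g k sq).plaqT c), dist1 (GaugeField.plaqHol ((sect3DataOfRecord F N ν M p g k sq).UkLoc c V') q.1) :=
  fibreIndep_comp_of_local _ (fun W => ⨆ q : ↥((sect3DataOfRecord F N ν M p g k sq).plaqT c), dist1 (GaugeField.plaqHol W q.1)) s hloc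

/-- ★ **def-T's (3.2) LABEL WEIGHT `aWeight` IS FIBRE-INDEPENDENT of any bond set under which the localized backgrounds of the cubes of its range are invariant** (14b's
mixed product form `aWeight_eq_prod_fac_smallInd` + file 21's `fibreIndep_prod_fac_smallInd`; off the range `aWeight = 0`). [cite: Balaban1988Convergent, (3.2) p.265] -/
theorem fibreIndep_aWeight_of_local [DecidableEq (PBond (F.P p.K) (k + 1))] (hε : 0 < epsOfRecord ν g (k + 1) * (F.P p.K).eta (k + 1) ^ 2)
    (sq : SeqOfRecord F ν M g p.K k) (Pl : Finset (Iχ F ν p g k)) (s : Finset (PBond (F.P p.K) (k + 1)))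
    (hloc : ∀ c ∈ cubes32 F ν M p g k sq, ∀ (V' : GaugeField (F.P p.K) (k + 1) (SU N)) (y : s → SU N),
      (sect3DataOfRecord F N ν M p g k sq).UkLoc c (Function.updateFinset V' s y) = (sect3DataOfRecord F N ν M p g k sq).UkLoc c V') :
    FibreIndep s (aWeight F N ν M p g k sq Pl) := by
  by_cases hPl : Pl ⊆ cubes32 F ν M p g k sq
  · have h := fibreIndep_prod_fac_smallInd s (cubes32 F ν M p g k sq) (fun c => if c ∈ Pl then Pol.large else Pol.small)
      (u := fun c (V' : GaugeField (F.P p.K) (k + 1) (SU N)) =>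
        ⨆ q : ↥((sect3DataOfRecord F N ν M p g k sq).plaqT c), dist1 (GaugeField.plaqHol ((sect3DataOfRecord F N ν M p g k sq).UkLoc c V') q.1))
      (fun c hc => fibreIndep_tStepStat32_of_local F N ν M p g k sq c s (hloc c hc))
      (fun _ => epsOfRecord ν g (k + 1) * (F.P p.K).eta (k + 1) ^ 2)
    intro V' y
    rw [aWeight_eq_prod_fac_smallInd F N ν M p g k hε sq hPl, aWeight_eq_prod_fac_smallInd F N ν M p g k hε sq hPl]
    exact h V' y
  · intro V' y
    unfold aWeight
    rw [if_neg hPl, if_neg hPl]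

end AtTStep

/-! ## §4 Guard at the EMPTY fibre: the typed (0.3) summand is the identity exactly on the receiver's support -/

section EmptyFibre

variable {P : Params} {j : ℕ} {G : Type*} [GaugeGroup G] [MeasurableSpace G] [HaarData G]
variable [DecidableEq (PBond P j)]

open Literature.MathematicalPhysics.QuantumFieldTheory.Balaban1983to89.B15.BasicStep (fibreIntegral normTerm)

/-- **GUARD.**  At the EMPTY fibre (no exhausted component at all) the typed (0.3) summand `normTerm ∅ new old` is `old` where the receiver is non-zero and
`0` where it vanishes — NOT the identity on indicator-carrying pieces unless the receiver's support contains the sender's: the selector-monotonicity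
hypothesis of file 20 §4 is load-bearing even before any fibre integral is taken. [cite: Balaban1989LargeFieldI, (0.3) p.176] -/
theorem normTerm_empty_eq_ite (new old : Density P j G) (V : GaugeField P j G) (hnew : 0 ≤ new V) (hold : 0 ≤ old V) :
    normTerm ∅ new old V = if new V = 0 then 0 else old V := by
  simp only [normTerm, T4JointDressingMany.fibreIntegral_empty V hnew, T4JointDressingMany.fibreIntegral_empty V hold]
  split_ifs with h
  · rw [h, zero_mul]
  · rw [mul_div_cancel₀ _ h]

end EmptyFibre

end Summit.QuantumFields.YangMills.Theorems.N21ThresholdMixtureRStepLocality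

end
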